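import Literature.MathematicalPhysics.QuantumFieldTheory.Balaban1983to89.B13ParametrixNeumannWalks
import Literature.MathematicalPhysics.QuantumFieldTheory.Balaban1983to89.B13JointWalkExpansionSymmetrize

/-!
# `Balaban1983to89.B13ChainWalkDecoration` — T. Bałaban, *Renormalization group approach to lattice gauge field theories.
II. Cluster expansions*, Commun. Math. Phys. **116** (1988) 1–22 [Balaban1988RG2Cluster], (1.11) p. 5 *"m is the number
of the parameters s connected with the walk ω"*, p. 3 (after (1.7)), p. 13 *"The parameters s(Δ), Δ ∈ σ₀, are introduced
into the operators as before"*, with [13] = [Balaban1985BackgroundPropagators] (3.106)–(3.108) p. 414–416 (the small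
factor `O(M^{−1/2})^{|ω|}` PER STEP of the walk): THE DECORATION GEOMETRY OF CHAIN WALKS — for the parametrix × Neumann
family of `B13ParametrixNeumannWalks` (walks = a seed piece followed by a chain of step pieces, each localised in a domain),
the decoration «σ₀-cubes met by the pieces' domains» has `|J(ω)| ≤ n_c(|ω| + 1)` — a bound in the NUMBER OF STEPS, not in
the walk distance — so print's dichotomy (P1) `|J ω| ≤ m₀ ∨ d_M·|J ω| ≤ ρ·D_ω` of `B13Eq111SDecoupling` (with its (P2)
letter `κ₁ρ ≤ η·d_M`) holds for the LENGTH-PENALISED walk distance `D_ω + s|ω|` as soon as `2n_cd_M ≤ ρs` — e.g.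
`d_M = κ₁ρ∕η`, `s = 2n_cκ₁∕η`: the price `e^{ρ_Rs} = e^{2n_cκ₁ρ_R∕η}` per step is a CONSTANT, paid, as in print, by the
per-step small factor (the chain smallness `q·e^{ε_Rs} < 1`, «M sufficiently large»); together with the through-clause
(a piece meeting a cube of σ₀ meets `X`) this delivers the N10 junction's structured datum `hKexp` FROM ONE-STEP FACTOR DATA

statement-level bookkeeping over published theorems with citation tags; kernel-checked compositions of tree theorems;
nothing here is a claim about the Yang–Mills mass gap.

WHY (cell `pub-ymgap`, D-0062 Track A, node N10 = [B13]; seat `pub-ymgap-dag-n10-c` g4, module 28; census v4 class A2″).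
Modules 25–27 inhabit the junction's σ-free expansion slot (A2′) by name for every kernel built by [13]'s construction from
one-step `IsDomainLocalD` factors; the decoration slot (A2″: a `J` with (P1)∕(P2)∕through) was still displayed.  For chain
walks the count of cubes met grows with the number of pieces while the (3.93) chain distance need not (consecutive domains
may overlap near one point), which is exactly why print's (1.11) carries BOTH `e^{−κd(ω)}` and `(M^{−1/2}O(1))^{|ω|}`: the
`e^{κ₁m}` of a long walk is absorbed by the per-step factor.  In the tree's D-form of (P1) this is a constant SHIFT `s` of
every step's walk distance (a legitimate, larger walk distance: domination and passage survive), costing `e^{ρ_Rs}` on the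
step amplitude and `e^{ε_Rs}` on the step constant — both inside the ONE margin smallness.

WHAT THIS FILE PROVES (all `theorem`s; no `def`, no instance, no notation).
§1 `jointWalkExpansion_shiftDist` — a joint walk expansion with distances `D_ω` is one with distances `D_ω + s` (`s ≥ 0`),
   amplitudes `A_ωe^{ρs}`, constant `e^{εs}K̄`; `domBy_shift`.
§2 `infConv_add_const`, `chainDist_shift` — `chainDist (D + s) D_S l = chainDist D D_S l + s·|l|`.
§3 The cube count of a chain: `card_chainCubes_le` (`|J(l,ω)| ≤ n_c(|l| + 1)` for `J(l,ω) = ⋃ cubes of the pieces`),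
   `chainCubes_nonempty`, ★ `dichotomy_chain` ((P1) in D-form for any non-negative `D` and the penalty `s|l|` under
   `2n_cd_M ≤ ρs`), `through_chainCubes` (the through-clause from «a piece with a cube meets `X`»).
§4 ★ `jointWalkExpansion_parametrixNeumann_pen` — module 27's σ-free parametrix × Neumann expansion with the step
   distances shifted by `s`: distances `chainDist + s|l|`, amplitudes `chainConst m c_μ (λ_Re^{ρ_Rs}) λ₀`, constant
   `K̄₀(1 − q_s)⁻¹`, smallness `q_s = (mc_μ)·(e^{ε_Rs}K̄_R)·c_μ < 1` (`ε_R = ρ_R − (ρ − ε)` the step window);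
   `domBy_parametrixNeumann_pen`.
§3′ `absorb_chain` — the AFFINE absorption `κ₁|J(l,ω)| ≤ κ₁n_c + η(D + s|l|)` under `κ₁n_c ≤ ηs` (no size letter).
§5 ★ `structuredExpansion_sandwich_sDecorate_symm_abs` — module 25's composite under the AFFINE absorption `habs` of
   `B13Eq111SDecoupling.jointWalkExpansion_sDecorate` (compositional: additive under products, available for chains);
   ★ `structuredExpansion_of_factorData` — THE COMPOSITE: σ-free one-step factor data `(L₀, L_R)` (`IsDomainLocalD`,
   no piece carrying a parameter) + cube assignments `cubes₀, cubes_R` (each piece meets `≤ n_c` cubes of σ₀; a piece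
   with a cube meets `X`) + a rate `0 ≤ η ≤ ε` and penalty `s ≥ 0` with `κ₁n_c ≤ ηs` + a real constant local `C` + fibre
   bounds + rates ⟹ module 21's `hKexp` ∃-datum (joint walk expansion ∧ s-monomial terms ∧ reversal) for the
   print-defined conditioned operator `Cᵀ·(sDecorate J′ T₀ˢʸᵐ)·C` built on `G₀·(1 − R)⁻¹` — census A2′ ∧ A2″ FROM
   FACTOR DATA.
HONEST FRAMING: MODEL ∕ MECHANISM level over HYPOTHESIS data; the cube assignments and their two counting letters are
binders (on Bałaban's carriers they are the (1.33)∕σ₀ cube geometry, `B13WalkCubes111`); NOTHING of Bałaban's `G_k(Ω)`,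
`Δ_k`, `C^{(k)}` is constructed or asserted; `Δ_k` is NOT literally one resolvent — its algebraic form in the propagators
([I] §1–2) composes by type-B13's algebra, and the decoration of sums ∕ products of penalised families is additive in the
same letters (not typed here); (D4) ∕ NODE A NOT discharged; count-neutral; NOT a discharge of N10; no `sorry`, no `def`,
no new named fact; standard axioms; nothing continuum ∕ ℝ⁴ ∕ OS ∕ mass gap ∕ Clay.
-/

noncomputable section

namespace Literature.MathematicalPhysics.QuantumFieldTheory.Balaban1983to89.B13ChainWalkDecoration

open Metric Set Finset
open scoped Matrix
open Literature.MathematicalPhysics.QuantumFieldTheory.Balaban1983to89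
open Literature.MathematicalPhysics.QuantumFieldTheory.Balaban1983to89.B9SectDWalk
  (Through MajSumLe DomBy infConv chainConst chainDist domBy_chainDist through_chainDist_seed through_chainDist_mem
    infConv_le exists_infConv_eq le_infConv)
open Literature.MathematicalPhysics.QuantumFieldTheory.Balaban1983to89.B9Thm34Ext (toB6)
open Literature.MathematicalPhysics.QuantumFieldTheory.Balaban1983to89.B9Thm37GlueTorus
  (torusGeom tdist1 tdist1_nonneg tdist1_comm hdnn_torusGeom htri_torusGeom)
open Literature.MathematicalPhysics.QuantumFieldTheory.Balaban1983to89.TreeLengthTorus (TPt)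
open Literature.MathematicalPhysics.QuantumFieldTheory.Balaban1983to89.B5TorusCover (UT)
open Literature.MathematicalPhysics.QuantumFieldTheory.Balaban1983to89.B11SectG (RowSum)
open Literature.MathematicalPhysics.QuantumFieldTheory.Balaban1983to89.B13JointWalkExpansion (JointWalkExpansion)
open Literature.MathematicalPhysics.QuantumFieldTheory.Balaban1983to89.B13LocalKernelWalks (rowSum_torus)
open Literature.MathematicalPhysics.QuantumFieldTheory.Balaban1983to89.B13DomainKernelWalks (DomainTerms)
open Literature.MathematicalPhysics.QuantumFieldTheory.Balaban1983to89.B13DomainKernelWalksDecay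
  (IsDomainLocalD jointWalkExpansion_domainLocalD)
open Literature.MathematicalPhysics.QuantumFieldTheory.Balaban1983to89.B13JointWalkExpansionNeumann
  (jointWalkExpansion_neumann_right)
open Literature.MathematicalPhysics.QuantumFieldTheory.Balaban1983to89.B13ParametrixNeumannWalks
  (jointWalkExpansion_congr_terms term_eq_op_of_card_le_zero kernel_eq_of_card_le_zero)
open Literature.MathematicalPhysics.QuantumFieldTheory.Balaban1983to89.B13Eq111SDecoupling (sDecorate)
open Literature.MathematicalPhysics.QuantumFieldTheory.Balaban1983to89.B13JointWalkExpansionSymmetrize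
  (structuredExpansion_sandwich_sDecorate_symm)

variable {ν : ℕ} {Nf : Fin ν → ℕ} [∀ i, NeZero (Nf i)]
variable {d N' : ℕ} {n q : Type}
variable {E : Type*} [NormedAddCommGroup E] [NormedSpace ℂ E]

/-! ## §1. A constant shift of the walk distances -/

section Shift

variable {p' : Type} {c : B13.Consts} {locp : p' → UT Nf} {locn : n → UT Nf} {K : (TPt d N' → ℂ) → E → Matrix p' n ℂ}
variable {X : Finset (UT Nf)} {R ε kap Kbar : ℝ}
variable {W : Type} {T : W → (TPt d N' → ℂ) → E → Matrix p' n ℂ} {SX : Set W} {A : W → ℝ}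
variable {D : W → UT Nf → UT Nf → ℝ} {ρ : ℝ}

/-- **A CONSTANT SHIFT OF EVERY WALK DISTANCE** ([13] (3.108): the per-step factor may be traded against the exponential
— a term bounded by `Ae^{−ρD}` is bounded by `(Ae^{ρs})e^{−ρ(D + s)}`): a joint walk expansion with distances `D_ω` is
one with distances `D_ω + s`, `s ≥ 0`, amplitudes `A_ωe^{ρs}`, the same ball ∕ drop ∕ torus rate and the constant
`e^{εs}K̄`; the σ-structure is untouched and passage through `X` survives (the distance only grew).  (Not to be confused
with the RATE shift `Spine/NE5/TwoRunPencilWalks.jointWalkExpansion_shift` of the Summit-side NE5 lineage.) [cite: Balaban1985BackgroundPropagators, (3.107)–(3.108) p.416, (3.93) p.410] -/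
theorem jointWalkExpansion_shiftDist (h : JointWalkExpansion c locp locn K X R ε kap Kbar T SX A D ρ) {s : ℝ} (hs : 0 ≤ s) :
    JointWalkExpansion c locp locn K X R ε kap (Real.exp (ε * s) * Kbar) T SX (fun ω => A ω * Real.exp (ρ * s))
      (fun ω a b => D ω a b + s) ρ where
  hasSum := h.hasSum
  termAnalytic := h.termAnalytic
  maj ω σ hσ u hu i j := by
    have e : A ω * Real.exp (ρ * s) * Real.exp (-(ρ * (D ω (locp i) (locn j) + s))) =
        A ω * Real.exp (-(ρ * D ω (locp i) (locn j))) := by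
      rw [mul_assoc, ← Real.exp_add]; congr 1; ring_nf
    rw [e]; exact h.maj ω σ hσ u hu i j
  majSum S a b := by
    have e : ∀ ω, A ω * Real.exp (ρ * s) * Real.exp (-((ρ - ε) * (D ω a b + s))) =
        Real.exp (ε * s) * (A ω * Real.exp (-((ρ - ε) * D ω a b))) := by
      intro ω
      have : Real.exp (ρ * s) * Real.exp (-((ρ - ε) * (D ω a b + s))) =
          Real.exp (ε * s) * Real.exp (-((ρ - ε) * D ω a b)) := by
        rw [← Real.exp_add, ← Real.exp_add]; congr 1; ring
      calc A ω * Real.exp (ρ * s) * Real.exp (-((ρ - ε) * (D ω a b + s)))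
          = A ω * (Real.exp (ρ * s) * Real.exp (-((ρ - ε) * (D ω a b + s)))) := by ring
        _ = Real.exp (ε * s) * (A ω * Real.exp (-((ρ - ε) * D ω a b))) := by rw [this]; ring
    calc ∑ ω ∈ S, A ω * Real.exp (ρ * s) * Real.exp (-((ρ - ε) * (D ω a b + s)))
        = Real.exp (ε * s) * ∑ ω ∈ S, A ω * Real.exp (-((ρ - ε) * D ω a b)) := by
          rw [Finset.mul_sum]; exact Finset.sum_congr rfl fun ω _ => e ω
      _ ≤ Real.exp (ε * s) * (Kbar * Real.exp (-(kap * tdist1 Nf a b))) :=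
          mul_le_mul_of_nonneg_left (h.majSum S a b) (Real.exp_pos _).le
      _ = Real.exp (ε * s) * Kbar * Real.exp (-(kap * tdist1 Nf a b)) := by ring
  indep := h.indep
  through ω hω y y' := by
    obtain ⟨z, hz, hle⟩ := h.through ω hω y y'
    exact ⟨z, hz, hle.trans (le_add_of_nonneg_right hs)⟩
  A_nonneg ω := mul_nonneg (h.A_nonneg ω) (Real.exp_pos _).le
  D_nonneg ω a b := add_nonneg (h.D_nonneg ω a b) hs

/-- Domination survives the shift. [cite: Balaban1984PropagatorsII, (2.54) p.233] -/
theorem domBy_shift {D₀ : UT Nf → UT Nf → ℝ} (h : DomBy (toB6 (torusGeom Nf 0 0 0) 0 True) D₀) {s : ℝ} (hs : 0 ≤ s) :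
    DomBy (toB6 (torusGeom Nf 0 0 0) 0 True) (fun a b => D₀ a b + s) :=
  fun y y' => (h y y').trans (le_add_of_nonneg_right hs)

end Shift

/-! ## §2. The chain distance of shifted steps is the chain distance plus `s` per step -/

section ChainShift

variable {ι : Type}

/-- The inf-convolution commutes with a constant shift of the left factor. [cite: Balaban1985BackgroundPropagators, (3.93) p.410] -/
theorem infConv_add_const (D₁ D₂ : UT Nf → UT Nf → ℝ) (s : ℝ) (y y' : UT Nf) :
    infConv (g := toB6 (torusGeom Nf 0 0 0) 0 True) (fun a b => D₁ a b + s) D₂ y y' =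
      infConv (g := toB6 (torusGeom Nf 0 0 0) 0 True) D₁ D₂ y y' + s := by
  apply le_antisymm
  · obtain ⟨y'', hy''⟩ := exists_infConv_eq (g := toB6 (torusGeom Nf 0 0 0) 0 True) D₁ D₂ y y'
    rw [hy'']
    exact (infConv_le (g := toB6 (torusGeom Nf 0 0 0) 0 True) (fun a b => D₁ a b + s) D₂ y y' y'').trans (by ring_nf; rfl)
  · obtain ⟨y'', hy''⟩ := exists_infConv_eq (g := toB6 (torusGeom Nf 0 0 0) 0 True) (fun a b => D₁ a b + s) D₂ y y'
    rw [hy'']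
    have h := infConv_le (g := toB6 (torusGeom Nf 0 0 0) 0 True) D₁ D₂ y y' y''
    linarith

/-- **The chain distance of shifted steps**: `chainDist (D + s) D_S l = chainDist D D_S l + s·|l|`.
[cite: Balaban1985BackgroundPropagators, (3.93) p.410, (3.108) p.416] -/
theorem chainDist_shift (D : ι → UT Nf → UT Nf → ℝ) (DS : UT Nf → UT Nf → ℝ) (s : ℝ) :
    ∀ (l : List ι) (a b : UT Nf), chainDist (g := toB6 (torusGeom Nf 0 0 0) 0 True) (fun i a b => D i a b + s) DS l a b =
      chainDist (g := toB6 (torusGeom Nf 0 0 0) 0 True) D DS l a b + s * l.length := by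
  intro l
  induction l with
  | nil => intro a b; simp
  | cons i l ih =>
      intro a b
      simp only [B9SectDWalk.chainDist_cons, List.length_cons, Nat.cast_succ]
      have e : chainDist (g := toB6 (torusGeom Nf 0 0 0) 0 True) (fun i a b => D i a b + s) DS l =
          fun a b => chainDist (g := toB6 (torusGeom Nf 0 0 0) 0 True) D DS l a b + s * l.length :=
        funext fun a => funext fun b => ih a b
      rw [e, infConv_add_const]
      -- shift of the RIGHT factor: `D □ (D' + t) = (D □ D') + t`
      have e2 : infConv (g := toB6 (torusGeom Nf 0 0 0) 0 True) (D i)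
            (fun a b => chainDist (g := toB6 (torusGeom Nf 0 0 0) 0 True) D DS l a b + s * l.length) a b =
          infConv (g := toB6 (torusGeom Nf 0 0 0) 0 True) (D i)
            (chainDist (g := toB6 (torusGeom Nf 0 0 0) 0 True) D DS l) a b + s * l.length := by
        apply le_antisymm
        · obtain ⟨y'', hy''⟩ := exists_infConv_eq (g := toB6 (torusGeom Nf 0 0 0) 0 True) (D i)
            (chainDist (g := toB6 (torusGeom Nf 0 0 0) 0 True) D DS l) a b
          rw [hy'']
          have h := infConv_le (g := toB6 (torusGeom Nf 0 0 0) 0 True) (D i)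
            (fun a b => chainDist (g := toB6 (torusGeom Nf 0 0 0) 0 True) D DS l a b + s * l.length) a b y''
          linarith
        · obtain ⟨y'', hy''⟩ := exists_infConv_eq (g := toB6 (torusGeom Nf 0 0 0) 0 True) (D i)
            (fun a b => chainDist (g := toB6 (torusGeom Nf 0 0 0) 0 True) D DS l a b + s * l.length) a b
          rw [hy'']
          have h := infConv_le (g := toB6 (torusGeom Nf 0 0 0) 0 True) (D i)
            (chainDist (g := toB6 (torusGeom Nf 0 0 0) 0 True) D DS l) a b y''
          linarith
      rw [e2]; ring

end ChainShift

/-! ## §3. The cube count of a chain walk: print's dichotomy (P1) in the number of steps, and the through-clause -/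

section Cubes

variable {WK WC ι' : Type} [DecidableEq ι']

omit [∀ i, NeZero (Nf i)] in
/-- **THE CUBE COUNT OF A CHAIN IS LINEAR IN THE NUMBER OF PIECES**: if every step piece meets `≤ n_c` cubes and every seed
piece meets `≤ n_c` cubes, the chain `(l, ω)` meets `≤ n_c(|l| + 1)` cubes (print (1.11): *"m is the number of the
parameters s connected with the walk ω"* — at most a fixed number per factor). [cite: Balaban1988RG2Cluster, (1.11) p.5, p.13] -/
theorem card_chainCubes_le (cubesK : WK → Finset ι') (cubesC : WC → Finset ι') {nc : ℕ}
    (hK : ∀ i, (cubesK i).card ≤ nc) (hC : ∀ ω, (cubesC ω).card ≤ nc) :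
    ∀ (l : List WK) (ω : WC), (l.foldr (fun i S => cubesK i ∪ S) (cubesC ω)).card ≤ nc * (l.length + 1) := by
  intro l ω
  induction l with
  | nil => simpa using hC ω
  | cons i l ih =>
      simp only [List.foldr_cons, List.length_cons]
      calc (cubesK i ∪ List.foldr (fun i S => cubesK i ∪ S) (cubesC ω) l).card
          ≤ (cubesK i).card + (List.foldr (fun i S => cubesK i ∪ S) (cubesC ω) l).card := Finset.card_union_le _ _
        _ ≤ nc + nc * (l.length + 1) := add_le_add (hK i) ih
        _ = nc * (l.length + 1 + 1) := by ring

omit [∀ i, NeZero (Nf i)] in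
/-- A chain meeting a cube has a piece meeting a cube. [cite: Balaban1988RG2Cluster, (1.11) p.5] -/
theorem chainCubes_nonempty (cubesK : WK → Finset ι') (cubesC : WC → Finset ι') :
    ∀ (l : List WK) (ω : WC), (l.foldr (fun i S => cubesK i ∪ S) (cubesC ω)).Nonempty →
      (cubesC ω).Nonempty ∨ ∃ i ∈ l, (cubesK i).Nonempty := by
  intro l ω
  induction l with
  | nil => intro h; exact Or.inl (by simpa using h)
  | cons i l ih =>
      intro h
      simp only [List.foldr_cons] at h
      rcases Finset.union_nonempty.1 h with h1 | h2
      · exact Or.inr ⟨i, by simp, h1⟩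
      · rcases ih h2 with h3 | ⟨j, hj, h4⟩
        · exact Or.inl h3
        · exact Or.inr ⟨j, by simp [hj], h4⟩

omit [∀ i, NeZero (Nf i)] in
/-- **PRINT's DICHOTOMY (P1) FOR CHAIN WALKS, IN D-FORM WITH A LENGTH PENALTY**: with `|J(l,ω)| ≤ n_c(|l| + 1)`, any
non-negative walk distance `D`, a letter `d_M ≥ 0` (the (P2) partner: `κ₁ρ ≤ η·d_M`), `ρ ≥ 0` and a per-step penalty `s`
with `2n_cd_M ≤ ρs`: `|J(l,ω)| ≤ n_c ∨ ∀ a b, d_M·|J(l,ω)| ≤ ρ·(D(a,b) + s|l|)` (seed alone: few cubes; chains: the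
penalty pays — print's `(M^{−1/2}O(1))^{|ω|}` absorbing `e^{κ₁m}`, [13] (3.108) ∕ [II] (1.11)).  With `d_M = κ₁ρ∕η`,
`s = 2n_cκ₁∕η` both constraints hold and the penalty is independent of the cube size. [cite: Balaban1988RG2Cluster, (1.11) p.5, p.13; Balaban1985BackgroundPropagators, (3.108) p.416] -/
theorem dichotomy_chain (cubesK : WK → Finset ι') (cubesC : WC → Finset ι') {nc : ℕ}
    (hK : ∀ i, (cubesK i).card ≤ nc) (hC : ∀ ω, (cubesC ω).card ≤ nc)
    {dM ρ s : ℝ} (hdM : 0 ≤ dM) (hρ : 0 ≤ ρ) (hs : 2 * nc * dM ≤ ρ * s)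
    {D : List WK × WC → UT Nf → UT Nf → ℝ} (hD : ∀ p a b, 0 ≤ D p a b) (p : List WK × WC) :
    (p.1.foldr (fun i S => cubesK i ∪ S) (cubesC p.2)).card ≤ nc ∨
      ∀ a b, dM * (p.1.foldr (fun i S => cubesK i ∪ S) (cubesC p.2)).card ≤ ρ * (D p a b + s * p.1.length) := by
  rcases Nat.eq_zero_or_pos p.1.length with h0 | hpos
  · left
    have hl : p.1 = [] := List.length_eq_zero_iff.1 h0
    rw [hl]; simpa using hC p.2
  · right
    intro a b
    have hcard := card_chainCubes_le cubesK cubesC hK hC p.1 p.2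
    have hlen : (1 : ℝ) ≤ p.1.length := by exact_mod_cast hpos
    have hcardR : ((p.1.foldr (fun i S => cubesK i ∪ S) (cubesC p.2)).card : ℝ) ≤ nc * (p.1.length + 1) := by
      exact_mod_cast hcard
    have hnc : (0 : ℝ) ≤ nc := Nat.cast_nonneg nc
    calc dM * ((p.1.foldr (fun i S => cubesK i ∪ S) (cubesC p.2)).card : ℝ)
        ≤ dM * (nc * (p.1.length + 1)) := mul_le_mul_of_nonneg_left hcardR hdM
      _ ≤ dM * (nc * (2 * p.1.length)) := by
          apply mul_le_mul_of_nonneg_left _ hdM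
          exact mul_le_mul_of_nonneg_left (by linarith) hnc
      _ = (2 * nc * dM) * p.1.length := by ring
      _ ≤ (ρ * s) * p.1.length := mul_le_mul_of_nonneg_right hs (by linarith)
      _ ≤ ρ * (D p a b + s * p.1.length) := by nlinarith [hD p a b]

omit [∀ i, NeZero (Nf i)] in
/-- **THE AFFINE ABSORPTION FOR CHAIN WALKS** (the hypothesis `habs` of `B13Eq111SDecoupling.jointWalkExpansion_sDecorate`
in its compositional form, no size letter): with `|J(l,ω)| ≤ n_c(|l| + 1)`, any non-negative walk distance `D`, `κ₁, η ≥ 0`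
and a per-step penalty `s` with `κ₁n_c ≤ ηs`: `κ₁·|J(l,ω)| ≤ κ₁·n_c + η·(D(a,b) + s|l|)` — the seed's cubes pay the constant
`e^{κ₁n_c}`, every step's cubes are paid by the step penalty (print's `e^{κ₁m}` against `(M^{−1/2}O(1))^{|ω|}`).
[cite: Balaban1988RG2Cluster, (1.11) p.5, p.13; Balaban1985BackgroundPropagators, (3.108) p.416] -/
theorem absorb_chain (cubesK : WK → Finset ι') (cubesC : WC → Finset ι') {nc : ℕ}
    (hK : ∀ i, (cubesK i).card ≤ nc) (hC : ∀ ω, (cubesC ω).card ≤ nc)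
    {κ₁ η s : ℝ} (hκ₁ : 0 ≤ κ₁) (hη : 0 ≤ η) (hs : κ₁ * nc ≤ η * s)
    {D : List WK × WC → UT Nf → UT Nf → ℝ} (hD : ∀ p a b, 0 ≤ D p a b) (p : List WK × WC) (a b : UT Nf) :
    κ₁ * ((p.1.foldr (fun i S => cubesK i ∪ S) (cubesC p.2)).card : ℝ) ≤ κ₁ * nc + η * (D p a b + s * p.1.length) := by
  have hcard := card_chainCubes_le cubesK cubesC hK hC p.1 p.2
  have hcardR : ((p.1.foldr (fun i S => cubesK i ∪ S) (cubesC p.2)).card : ℝ) ≤ nc * (p.1.length + 1) := by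
    exact_mod_cast hcard
  have hlen : (0 : ℝ) ≤ p.1.length := Nat.cast_nonneg _
  have hDab := hD p a b
  have h1 : κ₁ * ((p.1.foldr (fun i S => cubesK i ∪ S) (cubesC p.2)).card : ℝ) ≤ κ₁ * (nc * (p.1.length + 1)) :=
    mul_le_mul_of_nonneg_left hcardR hκ₁
  have h2 : κ₁ * nc * (p.1.length : ℝ) ≤ η * s * p.1.length := mul_le_mul_of_nonneg_right hs hlen
  nlinarith [mul_nonneg hη hDab]

/-- **THE THROUGH-CLAUSE FOR CHAIN WALKS**: if every piece with a cube has a walk distance passing through `X` (for a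
domain-localised piece: its domain meets `X`, `DomainTerms.through_dist`) and all distances dominate `d₁`, a chain meeting
a cube has a chain distance passing through `X` — and so has the penalised distance. [cite: Balaban1985BackgroundPropagators, (3.93) p.410, Thm 3.10 p.416; Balaban1988RG2Cluster, p.13] -/
theorem through_chainCubes (cubesK : WK → Finset ι') (cubesC : WC → Finset ι') {X : Finset (UT Nf)}
    {DK : WK → UT Nf → UT Nf → ℝ} {DC : WC → UT Nf → UT Nf → ℝ}
    (hKdom : ∀ i, DomBy (toB6 (torusGeom Nf 0 0 0) 0 True) (DK i))
    (hCdom : ∀ ω, DomBy (toB6 (torusGeom Nf 0 0 0) 0 True) (DC ω))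
    (hKX : ∀ i, (cubesK i).Nonempty → Through (toB6 (torusGeom Nf 0 0 0) 0 True) (DK i) (↑X : Set (UT Nf)))
    (hCX : ∀ ω, (cubesC ω).Nonempty → Through (toB6 (torusGeom Nf 0 0 0) 0 True) (DC ω) (↑X : Set (UT Nf)))
    {s : ℝ} (hs : 0 ≤ s) (p : List WK × WC)
    (hp : (p.1.foldr (fun i S => cubesK i ∪ S) (cubesC p.2)).Nonempty) :
    Through (toB6 (torusGeom Nf 0 0 0) 0 True)
      (fun a b => chainDist (g := toB6 (torusGeom Nf 0 0 0) 0 True) DK (DC p.2) p.1 a b + s * p.1.length)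
      (↑X : Set (UT Nf)) := by
  have hth : Through (toB6 (torusGeom Nf 0 0 0) 0 True)
      (chainDist (g := toB6 (torusGeom Nf 0 0 0) 0 True) DK (DC p.2) p.1) (↑X : Set (UT Nf)) := by
    rcases chainCubes_nonempty cubesK cubesC p.1 p.2 hp with hseed | ⟨i, hi, hstep⟩
    · exact through_chainDist_seed (htri_torusGeom 0 0 0 0 True) hKdom (hCX p.2 hseed) p.1
    · exact through_chainDist_mem (htri_torusGeom 0 0 0 0 True) hKdom (hCdom p.2) (hKX i hstep) p.1 hi
  intro y y'
  obtain ⟨z, hz, hle⟩ := hth y y'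
  exact ⟨z, hz, hle.trans (le_add_of_nonneg_right (mul_nonneg hs (Nat.cast_nonneg _)))⟩

end Cubes

/-! ## §4. The σ-free parametrix × Neumann expansion with length-penalised walk distances -/

section Penalised

variable [Fintype n] [DecidableEq n]
variable {c : B13.Consts} {locn : n → UT Nf} {locq : q → UT Nf} {X : Finset (UT Nf)} {R : ℝ}
variable {L₀ : DomainTerms d N' ν Nf q n E} {LR : DomainTerms d N' ν Nf n n E}
variable {lam₀ ρ₀ r₀ lamR ρR rR : ℝ} {n₀ nR m : ℕ}

/-- Flipping the arguments of a dominating distance (symmetry of `d₁`). [cite: Balaban1984PropagatorsII, (2.54) p.233] -/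
private theorem domBy_flip {D₀ : UT Nf → UT Nf → ℝ} (h : DomBy (toB6 (torusGeom Nf 0 0 0) 0 True) D₀) :
    DomBy (toB6 (torusGeom Nf 0 0 0) 0 True) (fun a b => D₀ b a) := fun y y' => by
  have h' := h y' y
  have e1 : (toB6 (torusGeom Nf 0 0 0) 0 True).dist y y' = tdist1 Nf y y' := rfl
  have e2 : (toB6 (torusGeom Nf 0 0 0) 0 True).dist y' y = tdist1 Nf y' y := rfl
  rw [e2] at h'; rw [e1, tdist1_comm y y']; exact h'

/-- Flipping the arguments of a distance passing through `X` (symmetry of `d₁`). [cite: Balaban1985BackgroundPropagators, (3.93) p.410] -/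
private theorem through_flip {D₀ : UT Nf → UT Nf → ℝ} {Y : Set (UT Nf)} (h : Through (toB6 (torusGeom Nf 0 0 0) 0 True) D₀ Y) :
    Through (toB6 (torusGeom Nf 0 0 0) 0 True) (fun a b => D₀ b a) Y := by
  intro y y'
  obtain ⟨z, hz, hle⟩ := h y' y
  refine ⟨z, hz, ?_⟩
  have e1 : (toB6 (torusGeom Nf 0 0 0) 0 True).dist y z = tdist1 Nf y z := rfl
  have e2 : (toB6 (torusGeom Nf 0 0 0) 0 True).dist z y' = tdist1 Nf z y' := rfl
  have e3 : (toB6 (torusGeom Nf 0 0 0) 0 True).dist y' z = tdist1 Nf y' z := rfl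
  have e4 : (toB6 (torusGeom Nf 0 0 0) 0 True).dist z y = tdist1 Nf z y := rfl
  rw [e1, e2]; rw [e3, e4] at hle
  rw [tdist1_comm y z, tdist1_comm z y']
  linarith

/-- **THE σ-FREE PARAMETRIX × NEUMANN EXPANSION WITH LENGTH-PENALISED WALK DISTANCES.**  Module 27's
`jointWalkExpansion_parametrixNeumann_sigmaFree` with every step distance shifted by `s ≥ 0` before the Neumann step:
DATA `IsDomainLocalD L₀ c locq locn X R λ₀ ρ₀ r₀ 0 n₀`, `IsDomainLocalD L_R c locn locn X R λ_R ρ_R r_R 0 n_R`, fibre `m`,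
target `(ρ, ε, κ)` and junction rate `μ > 0` with `κ + 2μ ≤ ρ − ε`, `ρ + μ ≤ ρ_R`, `ρ ≤ ρ₀`; the smallness
`q_s = (mc_μ)·(e^{(ρ_R − (ρ − ε))s}·K̄_R)·c_μ < 1`, `K̄_R = λ_Re^{μr_R}n_Rc_μ`.  CONCLUSION: a σ-free joint walk expansion
of `u ↦ (Σ_b F₀,b u)·(1 − Σ_a F_R,a u)⁻¹` through `X` at `(R, ε, κ, K̄₀(1 − q_s)⁻¹)` with terms
`F₀,b·F_R,iₙ⋯F_R,i₁`, amplitudes `chainConst m c_μ (λ_Re^{ρ_Rs}) λ₀ l`, distances `chainDist + s|l|` (read backwards,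
as in module 27), rate `ρ` — every letter free of `Nf`. [cite: Balaban1985BackgroundPropagators, (3.106) p.414, Thm 3.10 (3.107)–(3.108) p.416, (3.93) p.410, p.422; Balaban1988RG2Cluster, (1.11) p.5, p.13, p.15; Balaban1984PropagatorsII, Lemma 2.1 (2.61) p.234] -/
theorem jointWalkExpansion_parametrixNeumann_pen
    (h₀ : IsDomainLocalD L₀ c locq locn X R lam₀ ρ₀ r₀ 0 n₀) (hR : IsDomainLocalD LR c locn locn X R lamR ρR rR 0 nR)
    (hκ₁ : 0 ≤ c.κ₁) (hlam₀ : 0 ≤ lam₀) (hlamR : 0 ≤ lamR)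
    (hfib : ∀ y : UT Nf, (Finset.univ.filter fun k => locn k = y).card ≤ m)
    {ρ ε κ μ s : ℝ} (hμ : 0 < μ) (hε : 0 ≤ ε) (hκ : 0 ≤ κ) (hwin : κ + 2 * μ ≤ ρ - ε) (hρR : ρ + μ ≤ ρR) (hρ₀ : ρ ≤ ρ₀)
    (hs : 0 ≤ s)
    (hq : (m * B6.c0 1 μ ^ ν) * (Real.exp ((ρR - (ρ - ε)) * s) * (lamR * Real.exp (μ * rR) * (nR * B6.c0 1 μ ^ ν))) *
      B6.c0 1 μ ^ ν < 1) :
    JointWalkExpansion c locq locn (fun (_ : TPt d N' → ℂ) u => (∑ b, L₀.op b u) * (1 - ∑ a, LR.op a u)⁻¹) X R ε κ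
      ((lam₀ * Real.exp (μ * r₀) * (n₀ * B6.c0 1 μ ^ ν)) *
        (1 - (m * B6.c0 1 μ ^ ν) * (Real.exp ((ρR - (ρ - ε)) * s) * (lamR * Real.exp (μ * rR) * (nR * B6.c0 1 μ ^ ν))) *
          B6.c0 1 μ ^ ν)⁻¹)
      (fun (p : List LR.B × L₀.B) (_ : TPt d N' → ℂ) u => p.1.foldr (fun i M => M * LR.op i u) (L₀.op p.2 u))
      (∅ : Set (List LR.B × L₀.B))
      (fun p => chainConst (m : ℝ) (B6.c0 1 μ ^ ν) (fun _ : LR.B => lamR * Real.exp (ρR * s)) lam₀ p.1)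
      (fun p a b => chainDist (g := toB6 (torusGeom Nf 0 0 0) 0 True) (fun i a b => LR.dist X i b a)
        (fun a b => L₀.dist X p.2 b a) p.1 b a + s * p.1.length) ρ := by
  have hρ : 0 ≤ ρ := by linarith
  have hc : 0 ≤ B6.c0 1 μ ^ ν := pow_nonneg (B6RandomWalk.c0_nonneg 1 μ) ν
  have h0J : ∀ b, (L₀.J b).card ≤ 0 := h₀.hJ
  have hRJ : ∀ a, (LR.J a).card ≤ 0 := hR.hJ
  -- the two one-step families as joint walk expansions (reduced rates `ρ − ε`, torus rate `κ + μ`)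
  have hS := jointWalkExpansion_domainLocalD h₀ hκ₁ hlam₀ (ε := ρ₀ - (ρ - ε)) (κ := κ + μ) (μ := μ)
    (hρ.trans hρ₀) (by linarith) hμ.le (by linarith) (rowSum_torus Nf hμ)
  have hK := jointWalkExpansion_domainLocalD hR hκ₁ hlamR (ε := ρR - (ρ - ε)) (κ := κ + μ) (μ := μ)
    (by linarith) (by linarith) hμ.le (by linarith) (rowSum_torus Nf hμ)
  have e₀ : lam₀ * Real.exp (c.κ₁ * (0 : ℕ)) = lam₀ := by simp
  have eR : lamR * Real.exp (c.κ₁ * (0 : ℕ)) = lamR := by simp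
  -- shift the step distances by `s`
  have hKs := jointWalkExpansion_shiftDist hK hs
  have h := jointWalkExpansion_neumann_right (σ₁ := μ) (σ' := μ) (ρ := ρ) (ε := ε) (κ := κ) hKs hS
    (fun i => domBy_shift (LR.domBy_dist X i) hs) (fun b => L₀.domBy_dist X b) hfib (rowSum_torus Nf hμ) (rowSum_torus Nf hμ)
    hμ.le hμ.le hc (by linarith) hε (by linarith) hρR hρ₀ (by linarith) (by linarith) (by positivity) (by positivity) hκ
    (by linarith) (by linarith) (by rw [eR]; exact hq)
  -- read the data σ-free and identify the penalised distances and the letters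
  have hSX : {p : List LR.B × L₀.B | p.2 ∈ L₀.sigmaCarrying ∨ ∃ i ∈ p.1, i ∈ LR.sigmaCarrying} = ∅ := by
    ext p
    simp only [Set.mem_setOf_eq, Set.mem_empty_iff_false, iff_false, not_or, not_exists, not_and]
    refine ⟨fun hb => ?_, fun i _ hi => ?_⟩
    · have h : L₀.J p.2 = ∅ := Finset.card_eq_zero.1 (Nat.le_zero.1 (h0J p.2))
      exact (Finset.not_nonempty_iff_eq_empty.2 h) hb
    · have h : LR.J i = ∅ := Finset.card_eq_zero.1 (Nat.le_zero.1 (hRJ i))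
      exact (Finset.not_nonempty_iff_eq_empty.2 h) hi
  rw [hSX] at h
  have hdist : ∀ (p : List LR.B × L₀.B) (a b : UT Nf),
      chainDist (g := toB6 (torusGeom Nf 0 0 0) 0 True) (fun i a b => LR.dist X i b a + s)
          (fun a b => L₀.dist X p.2 b a) p.1 b a =
        chainDist (g := toB6 (torusGeom Nf 0 0 0) 0 True) (fun i a b => LR.dist X i b a) (fun a b => L₀.dist X p.2 b a) p.1 b a
          + s * p.1.length :=
    fun p a b => chainDist_shift (fun i a b => LR.dist X i b a) (fun a b => L₀.dist X p.2 b a) s p.1 b a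
  refine jointWalkExpansion_congr_terms (T := fun (p : List LR.B × L₀.B) σ u =>
      p.1.foldr (fun i M => M * LR.term i σ u) (L₀.term p.2 σ u)) ?_ fun p σ u => ?_
  · refine
      { hasSum := fun σ hσ u hu i j => by
          have hs' := h.hasSum σ hσ u hu i j
          rwa [kernel_eq_of_card_le_zero L₀ h0J, kernel_eq_of_card_le_zero LR hRJ] at hs'
        termAnalytic := h.termAnalytic
        maj := fun p σ hσ u hu i j => by
          have hm := h.maj p σ hσ u hu i j
          rw [hdist] at hm
          simpa only [e₀, eR] using hm
        majSum := fun S a b => by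
          have hms := h.majSum S a b
          simp only [hdist, e₀, eR] at hms
          exact hms
        indep := h.indep
        through := fun p hp => by simp at hp
        A_nonneg := fun p => by
          have ha := h.A_nonneg p
          simpa only [e₀, eR] using ha
        D_nonneg := fun p a b => by
          have hd := h.D_nonneg p a b
          rwa [hdist] at hd }
  · simp only [term_eq_op_of_card_le_zero L₀ h0J, term_eq_op_of_card_le_zero LR hRJ]

omit [Fintype n] [DecidableEq n] in
/-- **Domination for the penalised walk distances.** [cite: Balaban1984PropagatorsII, (2.54) p.233; Balaban1985BackgroundPropagators, (3.93) p.410] -/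
theorem domBy_parametrixNeumann_pen (X : Finset (UT Nf)) {s : ℝ} (hs : 0 ≤ s) (p : List LR.B × L₀.B) :
    DomBy (toB6 (torusGeom Nf 0 0 0) 0 True) (fun a b => chainDist (g := toB6 (torusGeom Nf 0 0 0) 0 True)
      (fun i a b => LR.dist X i b a) (fun a b => L₀.dist X p.2 b a) p.1 b a + s * p.1.length) := by
  intro y y'
  exact (B13ParametrixNeumannWalks.domBy_parametrixNeumann (L₀ := L₀) (LR := LR) X p y y').trans
    (le_add_of_nonneg_right (mul_nonneg hs (Nat.cast_nonneg _)))

end Penalised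

/-! ## §5. The structured datum from a σ-free expansion under the AFFINE absorption; then FROM ONE-STEP FACTOR DATA -/

section CompositeAbs

variable [Fintype n]
variable {c : B13.Consts} {locF : n → UT Nf} {locN : q → UT Nf} {Δ₀ : E → Matrix n n ℂ} {X : Finset (UT Nf)}
variable {R ε kap Kbar ρ : ℝ} {W : Type} {T₀ : W → E → Matrix n n ℂ} {SX₀ : Set W} {A : W → ℝ}
variable {D : W → UT Nf → UT Nf → ℝ}

/-- **MODULE 25's COMPOSITE UNDER THE AFFINE ABSORPTION** (`B13Eq111SDecoupling.jointWalkExpansion_sDecorate`'s own binder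
`habs : κ₁|J ω| ≤ κ₁m₀ + η·D_ω(a,b)` instead of the dichotomy (P1)∕(P2) — the compositional form: additive under products,
available for chain walks by `absorb_chain`): a σ-free joint walk expansion of `Δ₀` through `X` (distances dominating
`d₁`) + a decoration `J` with `habs` and the through-clause + a real constant local `C` + fibre bound + junction rate ⟹
the structured datum (`∃ W T SX A D ρ′ J′ T0 rev′`, joint walk expansion ∧ s-monomial terms ∧ reversal) for
`K = Cᵀ·(sDecorate J′ T₀ˢʸᵐ)·C`, `J′ = J ∘ Sum.elim id id`, `T₀ˢʸᵐ` the symmetrized family — module 24's constant.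
[cite: Balaban1988RG2Cluster, p.3, (1.11) p.5, (2.5) p.12, p.13, p.15; Balaban1985BackgroundPropagators, (3.93) p.410, (3.107)–(3.108) p.416, p.422, Thm 3.12 p.423; Balaban1984PropagatorsII, (2.54) p.233, Lemma 2.1 (2.61) p.234] -/
theorem structuredExpansion_sandwich_sDecorate_symm_abs (hκ₁ : 0 ≤ c.κ₁)
    (h₀ : JointWalkExpansion c locF locF (fun (_ : TPt d N' → ℂ) => Δ₀) X R ε kap Kbar
      (fun ω (_ : TPt d N' → ℂ) => T₀ ω) SX₀ A D ρ)
    (hdom : ∀ ω, DomBy (toB6 (torusGeom Nf 0 0 0) 0 True) (D ω))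
    (J : W → Finset (TPt d N')) {m₀ : ℕ} {η : ℝ} (hηε : η ≤ ε)
    (habs : ∀ ω a b, c.κ₁ * (J ω).card ≤ c.κ₁ * m₀ + η * D ω a b)
    (hX : ∀ ω, (J ω).Nonempty → Through (toB6 (torusGeom Nf 0 0 0) 0 True) (D ω) (↑X : Set (UT Nf)))
    (C : Matrix n q ℝ) {rC : ℝ} (hCle : ∀ k i, |C k i| ≤ 1)
    (hCsupp : ∀ k i, C k i ≠ 0 → tdist1 Nf (locF k) (locN i) ≤ rC)
    {mF : ℕ} (hfibF : ∀ y : UT Nf, (Finset.univ.filter fun k => locF k = y).card ≤ mF)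
    {μ : ℝ} (hμ : 0 < μ) (hμε : 2 * μ ≤ ε - η) (hμκ : 2 * μ ≤ kap) (hκε : kap ≤ (ρ - η) - (ε - η)) (hKbar : 0 ≤ Kbar) :
    ∃ (W' : Type) (T' : W' → (TPt d N' → ℂ) → E → Matrix q q ℂ) (SX' : Set W') (A' : W' → ℝ)
      (D' : W' → UT Nf → UT Nf → ℝ) (ρ' : ℝ) (J' : W' → Finset (TPt d N')) (T0' : W' → E → Matrix q q ℂ) (rev' : W' ≃ W'),
      JointWalkExpansion c locN locN
          (fun σ u => (C.map (algebraMap ℝ ℂ))ᵀ *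
            sDecorate (fun ω : W ⊕ W => J (Sum.elim id id ω))
              (fun ω u => Sum.elim (fun ω => (1 / 2 : ℂ) • T₀ ω u) (fun ω => (1 / 2 : ℂ) • (T₀ ω u)ᵀ) ω) σ u *
            C.map (algebraMap ℝ ℂ)) X R
          (ε - η - μ - μ) (kap - μ - μ)
          ((mF * B6.c0 1 μ ^ ν) * ((mF * B6.c0 1 μ ^ ν) * Real.exp ((ρ - η) * rC) * (Real.exp (c.κ₁ * m₀) * Kbar)
            * B6.c0 1 μ ^ ν) * Real.exp ((ρ - η - μ) * rC) * B6.c0 1 μ ^ ν) T' SX' A' D' ρ' ∧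
        (∀ ω σ u, T' ω σ u = (∏ j ∈ J' ω, σ j) • T0' ω u) ∧ (∀ ω σ u i j, T' (rev' ω) σ u i j = T' ω σ u j i) := by
  -- the symmetrized σ-free expansion (σ-slot ignored on both copies)
  have hs := B13JointWalkExpansionSymmetrize.jointWalkExpansion_symmetrize h₀ hKbar
  have hs' : JointWalkExpansion c locF locF
      (fun (_ : TPt d N' → ℂ) u => (1 / 2 : ℂ) • Δ₀ u + (1 / 2 : ℂ) • (Δ₀ u)ᵀ) X R ε kap Kbar
      (fun (ω : W ⊕ W) (_ : TPt d N' → ℂ) u =>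
        Sum.elim (fun ω => (1 / 2 : ℂ) • T₀ ω u) (fun ω => (1 / 2 : ℂ) • (T₀ ω u)ᵀ) ω)
      {ω | Sum.elim (· ∈ SX₀) (· ∈ SX₀) ω}
      (fun ω => Sum.elim (fun ω => (1 / 2 : ℝ) * A ω) (fun ω => (1 / 2 : ℝ) * A ω) ω)
      (fun ω => Sum.elim D (fun ω a b => D ω b a) ω) ρ := by
    convert hs using 2
  -- decorate under the affine absorption (both copies: the backwards copy reads `habs ω b a`)
  have habs' : ∀ (ω : W ⊕ W) a b, c.κ₁ * (J (Sum.elim id id ω)).card ≤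
      c.κ₁ * m₀ + η * Sum.elim D (fun ω a b => D ω b a) ω a b := by
    rintro (ω | ω) a b
    · exact habs ω a b
    · exact habs ω b a
  have hX' : ∀ ω : W ⊕ W, (J (Sum.elim id id ω)).Nonempty →
      Through (toB6 (torusGeom Nf 0 0 0) 0 True) (Sum.elim D (fun ω a b => D ω b a) ω) (↑X : Set (UT Nf)) := by
    rintro (ω | ω) hω
    · exact hX ω hω
    · exact B13JointWalkExpansionSymmetrize.through_symmetrize (hX ω hω)
  have hdec := B13Eq111SDecoupling.jointWalkExpansion_sDecorate hκ₁ hs' (fun ω => J (Sum.elim id id ω)) hηε habs' hX'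
  exact B13ConditioningSandwich.structuredExpansion_sandwich C hCle hCsupp hdec
    (B13JointWalkExpansionSymmetrize.domBy_symmetrize hdom) (fun ω => J (Sum.elim id id ω)) _
    (fun ω σ u => B13ConditioningDecoration.sTerm_eq_monomial_smul _ _ ω σ u) (Equiv.sumComm W W)
    (fun ω σ u i j => B13ConditioningDecoration.sTerm_reversal _ _ (Equiv.sumComm W W)
      (fun ω u i j => by rcases ω with ω | ω <;> simp [Matrix.smul_apply, Matrix.transpose_apply])
      (B13JointWalkExpansionSymmetrize.symmetrize_cubes J) ω σ u i j)
    hfibF hμ hμε hμκ hκε (mul_nonneg (Real.exp_pos _).le hKbar)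

end CompositeAbs

section Composite

variable [Fintype n] [DecidableEq n]
variable {c : B13.Consts} {locn : n → UT Nf} {locN : q → UT Nf} {X : Finset (UT Nf)} {R : ℝ}
variable {L₀ : DomainTerms d N' ν Nf n n E} {LR : DomainTerms d N' ν Nf n n E}
variable {lam₀ ρ₀ r₀ lamR ρR rR : ℝ} {n₀ nR m : ℕ}

/-- **CENSUS A2′ ∧ A2″ FROM FACTOR DATA — the `hKexp` ∃-datum of the N10 junction for the print-defined conditioned operator
built on a parametrix × Neumann kernel.**  DATA: σ-free one-step factor data `L₀` (square on the fine bonds `n`, located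
by `locn`) and `L_R` as in §4; cube assignments `cubes₀`, `cubes_R` (the σ₀-cubes met by each piece: `≤ n_c` per piece;
a piece with a cube has its domain meeting `X`); the (1.11) absorption letters: a rate `0 ≤ η ≤ ε` and a per-step penalty
`s ≥ 0` with `κ₁n_c ≤ ηs` (no size letter: the affine absorption `κ₁|J| ≤ κ₁n_c + η(D + s|l|)`, `absorb_chain`); a real
constant local `C` (`|C k i| ≤ 1`, range `r_C`), the fibre bounds `m` (of `locn`, for the junction sums) and `m_F` (for
the sandwich), a junction rate `μ > 0` for the chains (`κ + 2μ ≤ ρ − ε`, `ρ + μ ≤ ρ_R`, `ρ ≤ ρ₀`) and one `μ′ > 0` for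
the sandwich (`2μ′ ≤ ε − η`, `2μ′ ≤ κ`); the smallness `q_s < 1` of §4.  CONCLUSION: `∃ W′ T′ SX′ A′ D′ ρ′ J′ T0′ rev′`,
a joint walk expansion of `(σ,u) ↦ Cᵀ·(sDecorate J′ T₀ˢʸᵐ σ u)·C` through `X` at `(R, ε − η − 2μ′, κ − 2μ′, K̄_S)` with
s-monomial terms and a walk reversal — module 21's binder `hKexp` for that operator —, where `T₀ˢʸᵐ` is the symmetrized
chain family of `G₀·(1 − R)⁻¹` and `J′` reads the cubes met on both copies.  Composition: §4 → §3 (`absorb_chain`,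
`through_chainCubes`) → `structuredExpansion_sandwich_sDecorate_symm_abs`. [cite: Balaban1988RG2Cluster, p.3, (1.11) p.5, (2.5) p.12, p.13, p.15; Balaban1985BackgroundPropagators, (3.87) p.409, (3.105)–(3.106) p.414, (3.107)–(3.108) p.416, (3.93) p.410, p.422; Balaban1984PropagatorsII, (2.54) p.233, Lemma 2.1 (2.61) p.234] -/
theorem structuredExpansion_of_factorData
    (h₀ : IsDomainLocalD L₀ c locn locn X R lam₀ ρ₀ r₀ 0 n₀) (hR : IsDomainLocalD LR c locn locn X R lamR ρR rR 0 nR)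
    (hκ₁ : 0 ≤ c.κ₁) (hlam₀ : 0 ≤ lam₀) (hlamR : 0 ≤ lamR)
    (hfib : ∀ y : UT Nf, (Finset.univ.filter fun k => locn k = y).card ≤ m)
    {ρ ε κ μ s : ℝ} (hμ : 0 < μ) (hε : 0 ≤ ε) (hκ : 0 ≤ κ) (hwin : κ + 2 * μ ≤ ρ - ε) (hρR : ρ + μ ≤ ρR) (hρ₀ : ρ ≤ ρ₀)
    (hs : 0 ≤ s)
    (hq : (m * B6.c0 1 μ ^ ν) * (Real.exp ((ρR - (ρ - ε)) * s) * (lamR * Real.exp (μ * rR) * (nR * B6.c0 1 μ ^ ν))) *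
      B6.c0 1 μ ^ ν < 1)
    -- the decoration geometry: cubes met by the pieces
    (cubesR : LR.B → Finset (TPt d N')) (cubes₀ : L₀.B → Finset (TPt d N')) {nc : ℕ}
    (hcR : ∀ i, (cubesR i).card ≤ nc) (hc₀ : ∀ b, (cubes₀ b).card ≤ nc)
    (hcRX : ∀ i, (cubesR i).Nonempty → (LR.dom i ∩ X).Nonempty) (hc₀X : ∀ b, (cubes₀ b).Nonempty → (L₀.dom b ∩ X).Nonempty)
    {η : ℝ} (hη : 0 ≤ η) (hηε : η ≤ ε) (habs : c.κ₁ * nc ≤ η * s)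
    -- the averaging operator and the sandwich rates
    (C : Matrix n q ℝ) {rC : ℝ} (hCle : ∀ k i, |C k i| ≤ 1)
    (hCsupp : ∀ k i, C k i ≠ 0 → tdist1 Nf (locn k) (locN i) ≤ rC)
    {mF : ℕ} (hfibF : ∀ y : UT Nf, (Finset.univ.filter fun k => locn k = y).card ≤ mF)
    {μ' : ℝ} (hμ' : 0 < μ') (hμ'ε : 2 * μ' ≤ ε - η) (hμ'κ : 2 * μ' ≤ κ) :
    ∃ (W' : Type) (T' : W' → (TPt d N' → ℂ) → E → Matrix q q ℂ) (SX' : Set W') (A' : W' → ℝ)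
      (D' : W' → UT Nf → UT Nf → ℝ) (ρ' : ℝ) (J' : W' → Finset (TPt d N')) (T0' : W' → E → Matrix q q ℂ) (rev' : W' ≃ W'),
      JointWalkExpansion c locN locN
          (fun σ u => (C.map (algebraMap ℝ ℂ))ᵀ *
            sDecorate (fun ω : (List LR.B × L₀.B) ⊕ (List LR.B × L₀.B) =>
                (Sum.elim id id ω).1.foldr (fun i S => cubesR i ∪ S) (cubes₀ (Sum.elim id id ω).2))
              (fun ω u => Sum.elim
                (fun (p : List LR.B × L₀.B) => (1 / 2 : ℂ) • p.1.foldr (fun i M => M * LR.op i u) (L₀.op p.2 u))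
                (fun (p : List LR.B × L₀.B) => (1 / 2 : ℂ) • (p.1.foldr (fun i M => M * LR.op i u) (L₀.op p.2 u))ᵀ) ω)
              σ u *
            C.map (algebraMap ℝ ℂ)) X R
          (ε - η - μ' - μ') (κ - μ' - μ')
          ((mF * B6.c0 1 μ' ^ ν) * ((mF * B6.c0 1 μ' ^ ν) * Real.exp ((ρ - η) * rC) *
            (Real.exp (c.κ₁ * nc) * ((lam₀ * Real.exp (μ * r₀) * (n₀ * B6.c0 1 μ ^ ν)) *
              (1 - (m * B6.c0 1 μ ^ ν) * (Real.exp ((ρR - (ρ - ε)) * s) *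
                (lamR * Real.exp (μ * rR) * (nR * B6.c0 1 μ ^ ν))) * B6.c0 1 μ ^ ν)⁻¹))
            * B6.c0 1 μ' ^ ν) * Real.exp ((ρ - η - μ') * rC) * B6.c0 1 μ' ^ ν) T' SX' A' D' ρ' ∧
        (∀ ω σ u, T' ω σ u = (∏ j ∈ J' ω, σ j) • T0' ω u) ∧ (∀ ω σ u i j, T' (rev' ω) σ u i j = T' ω σ u j i) := by
  -- §4: the penalised σ-free expansion
  have hpen' := jointWalkExpansion_parametrixNeumann_pen h₀ hR hκ₁ hlam₀ hlamR hfib hμ hε hκ hwin hρR hρ₀ hs hq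
  have hKbar : 0 ≤ (lam₀ * Real.exp (μ * r₀) * (n₀ * B6.c0 1 μ ^ ν)) *
      (1 - (m * B6.c0 1 μ ^ ν) * (Real.exp ((ρR - (ρ - ε)) * s) * (lamR * Real.exp (μ * rR) * (nR * B6.c0 1 μ ^ ν))) *
        B6.c0 1 μ ^ ν)⁻¹ := by
    have hc : 0 ≤ B6.c0 1 μ ^ ν := pow_nonneg (B6RandomWalk.c0_nonneg 1 μ) ν
    exact mul_nonneg (by positivity) (inv_nonneg.2 (by linarith))
  -- §3: the decoration geometry of the chain family (affine absorption + through-clause)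
  have habs' := fun (p : List LR.B × L₀.B) (a b : UT Nf) => absorb_chain (Nf := Nf) cubesR cubes₀ hcR hc₀ hκ₁ hη habs
    (D := fun p a b => chainDist (g := toB6 (torusGeom Nf 0 0 0) 0 True) (fun i a b => LR.dist X i b a)
      (fun a b => L₀.dist X p.2 b a) p.1 b a)
    (fun p a b => (hdnn_torusGeom 0 0 0 b a).trans (domBy_chainDist (htri_torusGeom 0 0 0 0 True)
      (fun i => domBy_flip (LR.domBy_dist X i)) (domBy_flip (L₀.domBy_dist X p.2)) p.1 b a)) p a b
  have hthrough : ∀ p : List LR.B × L₀.B, (p.1.foldr (fun i S => cubesR i ∪ S) (cubes₀ p.2)).Nonempty →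
      Through (toB6 (torusGeom Nf 0 0 0) 0 True)
        (fun a b => chainDist (g := toB6 (torusGeom Nf 0 0 0) 0 True) (fun i a b => LR.dist X i b a)
          (fun a b => L₀.dist X p.2 b a) p.1 b a + s * p.1.length) (↑X : Set (UT Nf)) := by
    intro p hp
    have h := through_chainCubes (Nf := Nf) cubesR cubes₀ (X := X) (DK := fun i a b => LR.dist X i b a)
      (DC := fun b a a' => L₀.dist X b a' a) (fun i => domBy_flip (LR.domBy_dist X i))
      (fun b => domBy_flip (L₀.domBy_dist X b)) (fun i hi => through_flip (LR.through_dist (hcRX i hi)))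
      (fun b hb => through_flip (L₀.through_dist (hc₀X b hb))) hs p hp
    exact through_flip h
  exact structuredExpansion_sandwich_sDecorate_symm_abs hκ₁ hpen' (domBy_parametrixNeumann_pen X hs)
    (fun p => p.1.foldr (fun i S => cubesR i ∪ S) (cubes₀ p.2)) hηε habs' hthrough C hCle hCsupp hfibF hμ' hμ'ε
    hμ'κ (by linarith) hKbar

end Composite

end Literature.MathematicalPhysics.QuantumFieldTheory.Balaban1983to89.B13ChainWalkDecoration

end
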